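import Mathlib
import Summits.CriticalPhenomena.PercolationContinuityZ3.Theorems.PercNearOneGluingNoHeavyLowerTailFatMinorityHybridCertificate
import Summits.CriticalPhenomena.PercolationContinuityZ3.Theorems.PercNearOneGluingNoHeavyLowerTailFatMinorityRT4OfUT4
import HarnessLib

/-!
# `NoHeavyLowerTail` (stmt-CriticalPhenomena-4575), line fat-minority-linear — the up-set star inequality from an
# AVERAGED hybrid one-port certificate (route task `nh-dp-fatminority`, gen 11; FINDINGS-fat-minority-gen11 §2–§3)

Setting of `…FatMinorityHybridCertificate` / `…FatMinorityOnePortTarget`: `μ = prodBernoulli w`, observer `o ∉ A` isolated off `A`,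
up-set `𝒰 ⊆ 𝒫(A)`, `U = {ω | ∃ B ∈ 𝒰, ∀ u ∈ B, s(o,u) ∈ ω}`, vertices `c ≠ o`, `b`, anchor `a₀ ≠ o`; for a port `a`, `e_a = s(o,a)`,
`μ₁ᵃ = μ_{w[e_a ↦ 1]}`, `D_a = {c ↮ a}`, `U^a = {e_a open} ∩ U`.

For EVERY port `a` the split of `U` along `a` gives (`onePort_bracket` + `offPort_cells_hybrid`)
`μ({c↔b} ∩ U) − μ({o↔b} ∩ U) ≤ Br_a + L_a`,
`Br_a = w(e_a) · μ₁ᵃ(D_a ∩ U^a) · (μ₁ᵃ(c↔b) − μ₁ᵃ(a↔b)) / μ₁ᵃ(D_a)` (`0` if `μ₁ᵃ(D_a) = 0`) and `L_a` the hybrid cell sum over the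
members of `𝒰` avoiding `a`.  Averaging with any probability vector `q` on `A`:
`upsetStar_of_averagedCertificate`: if `Σ_a q_a (Br_a + L_a) ≤ t · μ(U)` then `μ({c↔b} ∩ U) − μ({o↔b} ∩ U) ≤ t · μ(U)`.
Point masses `q = δ_a` are the one-port certificates (p200072, p201793); the uniform / mass / pivotality-weighted averages are the
candidates (C2avg)/(H-mass)/(H-infl) of the notes.  No definitions.
-/

namespace Summit.CriticalPhenomena.PercolationContinuityZ3.Theorems

open MeasureTheory Set
open Literature.Probability.LatticeModels (prodBernoulli)
open Literature.Probability.Percolation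

noncomputable section
open scoped Classical

variable {n : ℕ}

/-- **One port, both halves**: for every port `a ∈ A`,
`μ({c↔b} ∩ U) − μ({o↔b} ∩ U) ≤ Br_a + L_a` (notation of the module docstring).
[cite: KozmaNitzan2024, Lemma 3 p. 6 and Lemma 5 p. 13; VandenbergHaggstromKahn2005, Thm. 1.5; combination: route notes gen 9/11] -/
theorem upsetStar_le_bracket_add_cells (w : Sym2 (Fin n) → unitInterval) (A : Finset (Fin n))
    (o a c b a₀ : Fin n) (hoA : o ∉ A) (haA : a ∈ A) (hco : c ≠ o) (ha₀o : a₀ ≠ o)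
    (hiso : ∀ u, u ≠ o → u ∉ A → w s(o, u) = 0)
    (𝒰 : Finset (Finset (Fin n))) (h𝒰A : 𝒰 ⊆ A.powerset)
    (hup : ∀ B ∈ 𝒰, ∀ B' ∈ A.powerset, B ⊆ B' → B' ∈ 𝒰)
    (v : Finset (Fin n) → Fin n) (hv : ∀ B ∈ 𝒰, a ∉ B → v B ∈ B)
    (u : Finset (Fin n) → Fin n) (hu : ∀ B ∈ 𝒰, a ∉ B → u B ∈ B)
    (hanchor : ∀ B ∈ 𝒰, a ∉ B → (prodBernoulli w).real (openConnIn ({o}ᶜ : Set (Fin n)) a₀ b) ≤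
      (prodBernoulli w).real (openConnIn ({o}ᶜ : Set (Fin n)) (u B) b)) :
    (prodBernoulli w).real (openConn c b ∩ {ω | ∃ B ∈ 𝒰, ∀ u ∈ B, s(o, u) ∈ ω}) -
        (prodBernoulli w).real (openConn o b ∩ {ω | ∃ B ∈ 𝒰, ∀ u ∈ B, s(o, u) ∈ ω}) ≤
      (if (prodBernoulli (Function.update w s(o, a) 1)).real (openConn c a)ᶜ = 0 then 0 else
          (w s(o, a) : ℝ) *
              (prodBernoulli (Function.update w s(o, a) 1)).real
                ((openConn c a)ᶜ ∩ ({ω | s(o, a) ∈ ω} ∩ {ω | ∃ B ∈ 𝒰, ∀ u ∈ B, s(o, u) ∈ ω})) *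
              ((prodBernoulli (Function.update w s(o, a) 1)).real (openConn c b) -
                (prodBernoulli (Function.update w s(o, a) 1)).real (openConn a b)) /
            (prodBernoulli (Function.update w s(o, a) 1)).real (openConn c a)ᶜ) +
        ∑ B ∈ 𝒰.filter (fun B => a ∉ B),
          min (max 0 ((prodBernoulli w).real (openConnIn ({o}ᶜ : Set (Fin n)) c b) -
                (prodBernoulli w).real (openConnIn ({o}ᶜ : Set (Fin n)) (v B) b)) *
              (prodBernoulli w).real (starEvent o (↑B : Set (Fin n))))
            ((prodBernoulli w).real (openConn c b ∩ starEvent o (↑B : Set (Fin n))) -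
              (prodBernoulli w).real (openConn a₀ b ∩ starEvent o (↑B : Set (Fin n)))) := by
  set μ := prodBernoulli w with hμ
  set μ₁ := prodBernoulli (Function.update w s(o, a) 1) with hμ₁
  set U : Set (BondConfig (Fin n)) := {ω | ∃ B ∈ 𝒰, ∀ u ∈ B, s(o, u) ∈ ω} with hU
  set Ua : Set (BondConfig (Fin n)) := {ω | s(o, a) ∈ ω} ∩ U with hUa
  have hao : a ≠ o := fun h => hoA (h ▸ haA)
  have hsc := real_inter_upEvent_split μ s(o, a) (openConn c b) U
  have hso := real_inter_upEvent_split μ s(o, a) (openConn o b) U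
  have hoff := offPort_cells_hybrid w A o a c b a₀ hoA haA hco ha₀o hiso 𝒰 h𝒰A hup v hv u hu hanchor
  have hbr := onePort_bracket w A o a c b hoA haA 𝒰 h𝒰A
  -- the cells containing `a`
  have hX : μ.real (openConn c b ∩ Ua) - μ.real (openConn o b ∩ Ua) ≤
      (if μ₁.real (openConn c a)ᶜ = 0 then 0 else
        (w s(o, a) : ℝ) * μ₁.real ((openConn c a)ᶜ ∩ Ua) * (μ₁.real (openConn c b) - μ₁.real (openConn a b)) /
          μ₁.real (openConn c a)ᶜ) := by
    split_ifs with hD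
    · -- `c ↔ a` a.s. under `μ₁`: the two events agree on `U^a`
      have hUa_open : Ua ⊆ {ω | s(o, a) ∈ ω} := fun ω hω => hω.1
      have hc : μ.real (openConn c b ∩ Ua) = (w s(o, a) : ℝ) * μ₁.real (openConn c b ∩ Ua) :=
        real_of_subset_edgeOpen w s(o, a) _ (fun ω hω => hUa_open hω.2)
      have ho : μ.real (openConn o b ∩ Ua) = (w s(o, a) : ℝ) * μ₁.real (openConn a b ∩ Ua) := by
        rw [hUa, openConn_inter_edgeOpen_eq hao b]
        exact real_of_subset_edgeOpen w s(o, a) _ (fun ω hω => hUa_open hω.2)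
      rw [hc, ho, real_openConn_inter_eq_of_notConn_null μ₁ c a b Ua hD, sub_self]
    · have hpos : 0 < μ₁.real (openConn c a)ᶜ := lt_of_le_of_ne measureReal_nonneg (Ne.symm hD)
      rw [le_div_iff₀ hpos]
      nlinarith [hbr]
  rw [hsc, hso]
  linarith [hX, hoff]

/-- **The up-set star inequality from an averaged hybrid certificate.**  For any weights `q ≥ 0` on `A` with `Σ_a q_a = 1`
(port-dependent selectors `v a`, `u a` and a common anchor `a₀` as in `offPort_cells_hybrid`): if
`Σ_{a∈A} q_a · (Br_a + L_a) ≤ t · μ(U)` then `μ({c↔b} ∩ U) − μ({o↔b} ∩ U) ≤ t · μ(U)`.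
[cite: KozmaNitzan2024, Lemma 3 p. 6 and Lemma 5 p. 13; VandenbergHaggstromKahn2005, Thm. 1.5; combination: route notes gen 11 §2–§3] -/
theorem upsetStar_of_averagedCertificate (w : Sym2 (Fin n) → unitInterval) (A : Finset (Fin n))
    (o c b a₀ : Fin n) (hoA : o ∉ A) (hco : c ≠ o) (ha₀o : a₀ ≠ o)
    (hiso : ∀ u, u ≠ o → u ∉ A → w s(o, u) = 0)
    (𝒰 : Finset (Finset (Fin n))) (h𝒰A : 𝒰 ⊆ A.powerset)
    (hup : ∀ B ∈ 𝒰, ∀ B' ∈ A.powerset, B ⊆ B' → B' ∈ 𝒰)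
    (v : Fin n → Finset (Fin n) → Fin n) (hv : ∀ a ∈ A, ∀ B ∈ 𝒰, a ∉ B → v a B ∈ B)
    (u : Fin n → Finset (Fin n) → Fin n) (hu : ∀ a ∈ A, ∀ B ∈ 𝒰, a ∉ B → u a B ∈ B)
    (hanchor : ∀ a ∈ A, ∀ B ∈ 𝒰, a ∉ B → (prodBernoulli w).real (openConnIn ({o}ᶜ : Set (Fin n)) a₀ b) ≤
      (prodBernoulli w).real (openConnIn ({o}ᶜ : Set (Fin n)) (u a B) b))
    (q : Fin n → ℝ) (hq0 : ∀ a ∈ A, 0 ≤ q a) (hq1 : ∑ a ∈ A, q a = 1) (t : ℝ)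
    (hcert : ∑ a ∈ A, q a *
        ((if (prodBernoulli (Function.update w s(o, a) 1)).real (openConn c a)ᶜ = 0 then 0 else
            (w s(o, a) : ℝ) *
                (prodBernoulli (Function.update w s(o, a) 1)).real
                  ((openConn c a)ᶜ ∩ ({ω | s(o, a) ∈ ω} ∩ {ω | ∃ B ∈ 𝒰, ∀ u ∈ B, s(o, u) ∈ ω})) *
                ((prodBernoulli (Function.update w s(o, a) 1)).real (openConn c b) -
                  (prodBernoulli (Function.update w s(o, a) 1)).real (openConn a b)) /
              (prodBernoulli (Function.update w s(o, a) 1)).real (openConn c a)ᶜ) +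
          ∑ B ∈ 𝒰.filter (fun B => a ∉ B),
            min (max 0 ((prodBernoulli w).real (openConnIn ({o}ᶜ : Set (Fin n)) c b) -
                  (prodBernoulli w).real (openConnIn ({o}ᶜ : Set (Fin n)) (v a B) b)) *
                (prodBernoulli w).real (starEvent o (↑B : Set (Fin n))))
              ((prodBernoulli w).real (openConn c b ∩ starEvent o (↑B : Set (Fin n))) -
                (prodBernoulli w).real (openConn a₀ b ∩ starEvent o (↑B : Set (Fin n))))) ≤
      t * (prodBernoulli w).real {ω | ∃ B ∈ 𝒰, ∀ u ∈ B, s(o, u) ∈ ω}) :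
    (prodBernoulli w).real (openConn c b ∩ {ω | ∃ B ∈ 𝒰, ∀ u ∈ B, s(o, u) ∈ ω}) -
        (prodBernoulli w).real (openConn o b ∩ {ω | ∃ B ∈ 𝒰, ∀ u ∈ B, s(o, u) ∈ ω}) ≤
      t * (prodBernoulli w).real {ω | ∃ B ∈ 𝒰, ∀ u ∈ B, s(o, u) ∈ ω} := by
  set X := (prodBernoulli w).real (openConn c b ∩ {ω | ∃ B ∈ 𝒰, ∀ u ∈ B, s(o, u) ∈ ω}) -
      (prodBernoulli w).real (openConn o b ∩ {ω | ∃ B ∈ 𝒰, ∀ u ∈ B, s(o, u) ∈ ω}) with hX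
  have hper := fun a (ha : a ∈ A) =>
    upsetStar_le_bracket_add_cells w A o a c b a₀ hoA ha hco ha₀o hiso 𝒰 h𝒰A hup (v a) (hv a ha) (u a) (hu a ha)
      (hanchor a ha)
  have hsum : ∑ a ∈ A, q a * X ≤ ∑ a ∈ A, q a *
        ((if (prodBernoulli (Function.update w s(o, a) 1)).real (openConn c a)ᶜ = 0 then 0 else
            (w s(o, a) : ℝ) *
                (prodBernoulli (Function.update w s(o, a) 1)).real
                  ((openConn c a)ᶜ ∩ ({ω | s(o, a) ∈ ω} ∩ {ω | ∃ B ∈ 𝒰, ∀ u ∈ B, s(o, u) ∈ ω})) *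
                ((prodBernoulli (Function.update w s(o, a) 1)).real (openConn c b) -
                  (prodBernoulli (Function.update w s(o, a) 1)).real (openConn a b)) /
              (prodBernoulli (Function.update w s(o, a) 1)).real (openConn c a)ᶜ) +
          ∑ B ∈ 𝒰.filter (fun B => a ∉ B),
            min (max 0 ((prodBernoulli w).real (openConnIn ({o}ᶜ : Set (Fin n)) c b) -
                  (prodBernoulli w).real (openConnIn ({o}ᶜ : Set (Fin n)) (v a B) b)) *
                (prodBernoulli w).real (starEvent o (↑B : Set (Fin n))))
              ((prodBernoulli w).real (openConn c b ∩ starEvent o (↑B : Set (Fin n))) -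
                (prodBernoulli w).real (openConn a₀ b ∩ starEvent o (↑B : Set (Fin n))))) :=
    Finset.sum_le_sum fun a ha => mul_le_mul_of_nonneg_left (by simpa only [hX] using hper a ha) (hq0 a ha)
  have hone : ∑ a ∈ A, q a * X = X := by rw [← Finset.sum_mul, hq1, one_mul]
  rw [hone] at hsum
  exact hsum.trans hcert

end

end Summit.CriticalPhenomena.PercolationContinuityZ3.Theorems
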